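import Literature.Computability.AlgebraicComplexity.TableauEvalSparseEntry
import Literature.Computability.AlgebraicComplexity.TableauEvalLabelMajorImpl
import HarnessLib

/-!
# The sparse entry trie holds the symmetric-tensor entries; `evalS = evalC` — proofs

Proofs file for `TableauEvalSparseEntry.lean` (Lean certificate checker of the GCT
multiplicity-obstruction engine, cells `pub-gct` / `pub-gct-max`; honest framing of those cells:
multiplicity-obstruction search for permanent versus determinant at small `(n, m)`; a kernel-checked lower
bound at a small parameter is negative census or a certificate ingredient, never a claim about VP ≠ VNP or
P ≠ NP).

§1 lookups in tries built by insertion and under pruning (private helpers); §2 the ordered expansion of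
one arranged product of linear forms sums, at a word, to the product of the looked-up coefficients, and the
symmetrised expansion sums to `symEntry` (column expansion of the permanent, via the tree's
`lperm_eq_permanent` and `sum_permsSign_range`; private helpers); §3 **`find_sparseTrie`**:
`(sparseTrie P V m).find w = symEntry P w` for words of length `m` with letters `< V`; §4 the chunking
identity **`layersA_append`**; §5 **`evalS_eq_evalC`** by the tree's trie-parametric chain
(`layerSum_layersA`, `specL_eq_evalC`, `symEntry_eq_S`). Elementary list bookkeeping around the evaluation
formula of [DorflerIkenmeyerPanova2020, §5]; the private helpers are [folklore].

## References
* [DorflerIkenmeyerPanova2020] J. Dörfler, C. Ikenmeyer, G. Panova, *On geometric complexity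
  theory: multiplicity obstructions are stronger than occurrence obstructions*, SIAM J. Appl.
  Algebra Geom. 4 (2020) = arXiv:1901.04576, §5.
-/

open scoped BigOperators

namespace Literature.Computability.AlgebraicComplexity

namespace TableauEval

variable {R : Type*} [CommRing R] [DecidableEq R]

/-! ## §1 Tries built by insertion -/

omit [CommRing R] [DecidableEq R] in
/-- Children after `setPad`: position `i` holds `t`, the others are unchanged (default `empty`).
[folklore] -/
private theorem PTrie.getD_setPad : ∀ (ts : List (PTrie R)) (i : ℕ) (t : PTrie R) (j : ℕ),
    (PTrie.setPad ts i t).getD j .empty = if j = i then t else ts.getD j .empty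
  | [], 0, t, 0 => by simp [PTrie.setPad]
  | [], 0, t, j + 1 => by simp [PTrie.setPad]
  | [], i + 1, t, 0 => by simp [PTrie.setPad]
  | [], i + 1, t, j + 1 => by
    rw [PTrie.setPad, List.getD_cons_succ, PTrie.getD_setPad [] i t j]
    simp
  | s :: ts, 0, t, 0 => by simp [PTrie.setPad]
  | s :: ts, 0, t, j + 1 => by simp [PTrie.setPad]
  | s :: ts, i + 1, t, 0 => by simp [PTrie.setPad]
  | s :: ts, i + 1, t, j + 1 => by
    rw [PTrie.setPad, List.getD_cons_succ, PTrie.getD_setPad ts i t j, List.getD_cons_succ]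
    simp

omit [DecidableEq R] in
/-- Looking up a nonempty word in a node. [folklore] -/
private theorem PTrie.find_cons_node (i : ℕ) (is : List ℕ) (ts : List (PTrie R)) :
    (PTrie.node ts).find (i :: is) = (ts.getD i .empty).find is := rfl

omit [DecidableEq R] in
/-- **Insertion with addition adds at its word and nowhere else** (among words of the same length).
[folklore] -/
private theorem PTrie.find_insertAdd : ∀ (w u : List ℕ) (a : R) (T : PTrie R), u.length = w.length →
    (T.insertAdd w a).find u = T.find u + if u = w then a else 0
  | [], [], a, T, _ => by
    cases T <;> simp [PTrie.insertAdd, PTrie.find]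
  | [], _ :: _, _, _, h => by simp at h
  | _ :: _, [], _, _, h => by simp at h
  | i :: is, j :: js, a, T, h => by
    have h' : js.length = is.length := by simpa using h
    have key : ∀ ts : List (PTrie R),
        (PTrie.node (PTrie.setPad ts i (PTrie.insertAdd is a (ts.getD i .empty)))).find (j :: js) =
          (PTrie.node ts).find (j :: js) + if j :: js = i :: is then a else 0 := by
      intro ts
      rw [PTrie.find_cons_node, PTrie.find_cons_node, PTrie.getD_setPad]
      by_cases hji : j = i
      · subst hji
        rw [if_pos rfl, PTrie.find_insertAdd is js a _ h']
        simp
      · rw [if_neg hji]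
        simp [hji]
    have key0 := key []
    rw [List.getD_nil] at key0
    cases T with
    | empty =>
      rw [PTrie.insertAdd, key0]
      simp [PTrie.find]
    | leaf b =>
      rw [PTrie.insertAdd, key0]
      simp [PTrie.find]
    | node ts => rw [PTrie.insertAdd, key ts]

omit [DecidableEq R] in
/-- Lookups after folding insertions over a list. [folklore] -/
private theorem PTrie.find_foldl_insertAdd (m : ℕ) (u : List ℕ) (hu : u.length = m) :
    ∀ (L : List (List ℕ × R)) (T : PTrie R), (∀ e ∈ L, e.1.length = m) →
      (L.foldl (fun T e => T.insertAdd e.1 e.2) T).find u =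
        T.find u + (L.map fun e => if u = e.1 then e.2 else 0).sum
  | [], T, _ => by simp
  | e :: L, T, hL => by
    rw [List.foldl_cons, PTrie.find_foldl_insertAdd m u hu L _ (fun e' he' => hL e' (List.mem_cons_of_mem _ he')),
      PTrie.find_insertAdd _ _ _ _ (by rw [hu, hL e List.mem_cons_self]), List.map_cons,
      List.sum_cons, add_assoc]

omit [DecidableEq R] in
/-- **Lookups in the trie of a list**: the sum of the contributions at that word. [folklore] -/
private theorem PTrie.find_ofList (L : List (List ℕ × R)) (m : ℕ) (hL : ∀ e ∈ L, e.1.length = m)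
    (u : List ℕ) (hu : u.length = m) :
    (PTrie.ofList L).find u = (L.map fun e => if u = e.1 then e.2 else 0).sum := by
  unfold PTrie.ofList
  rw [PTrie.find_foldl_insertAdd m u hu L _ hL, PTrie.find_empty, zero_add]

/-- **Pruning does not change lookups.** [folklore] -/
private theorem PTrie.find_prune : ∀ (k : ℕ) (T : PTrie R) (u : List ℕ), (PTrie.prune k T).find u = T.find u
  | k, .empty, u => by cases k <;> simp [PTrie.prune]
  | k, .leaf a, u => by
    have h : PTrie.prune k (.leaf a) = PTrie.mkLeaf a := by cases k <;> rfl
    rw [h, PTrie.mkLeaf]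
    split_ifs with ha
    · subst ha; cases u <;> simp [PTrie.find]
    · rfl
  | 0, .node ts, u => rfl
  | k + 1, .node ts, u => by
    rw [PTrie.prune, PTrie.mkNode]
    have hget : ∀ i, (ts.map (PTrie.prune k)).getD i .empty = PTrie.prune k (ts.getD i .empty) :=
      fun i => getD_map_congr (PTrie.prune k) (by cases k <;> rfl) ts i
    split_ifs with hall
    · rw [PTrie.find_empty]
      cases u with
      | nil => simp [PTrie.find]
      | cons i is =>
        rw [PTrie.find_cons_node, ← PTrie.find_prune k (ts.getD i .empty) is, ← hget]
        by_cases hi : i < (ts.map (PTrie.prune k)).length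
        · have hmem : (ts.map (PTrie.prune k)).getD i .empty ∈ ts.map (PTrie.prune k) := by
            rw [List.getD_eq_getElem _ _ hi]; exact List.getElem_mem _
          rw [(PTrie.isEmpty_iff _).mp ((List.all_eq_true.mp hall) _ hmem), PTrie.find_empty]
        · rw [List.getD_eq_default _ _ (Nat.le_of_not_lt hi), PTrie.find_empty]
    · cases u with
      | nil => simp [PTrie.find]
      | cons i is => rw [PTrie.find_cons_node, PTrie.find_cons_node, hget, PTrie.find_prune k]

/-! ## §2 The expansions sum to the looked-up products and to `symEntry` -/

omit [CommRing R] [DecidableEq R] in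
/-- An indicator sum over a duplicate-free list picks out the member. [folklore] -/
private theorem sum_map_ite_eq_of_nodup {M : Type*} [AddCommMonoid M] (a : ℕ) (c : ℕ → M) :
    ∀ (S : List ℕ), S.Nodup → (S.map fun v => if a = v then c v else 0).sum = if a ∈ S then c a else 0
  | [], _ => by simp
  | v :: S, h => by
    rw [List.nodup_cons] at h
    rw [List.map_cons, List.sum_cons, sum_map_ite_eq_of_nodup a c S h.2]
    by_cases hav : a = v
    · subst hav
      simp [h.1]
    · simp [hav]

/-- Membership in the support: a nonzero coefficient (for variables below the bound). [folklore] -/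
private theorem mem_support_iff (V : ℕ) (ℓ : List R) (v : ℕ) (hv : v < V) :
    v ∈ support V ℓ ↔ ℓ.getD v 0 ≠ 0 := by
  simp [support, List.mem_filter, hv]

/-- The support is duplicate-free. [folklore] -/
private theorem nodup_support (V : ℕ) (ℓ : List R) : (support V ℓ).Nodup :=
  (List.nodup_range).filter _

/-- The support of the empty coefficient list is empty. [folklore] -/
private theorem support_nil (V : ℕ) : support V ([] : List R) = [] := by
  simp [support]

/-- **The ordered expansion sums, at a word, to the product of the looked-up coefficients**
(words outside the supports have a zero factor). [folklore] -/
private theorem sum_termWords (V : ℕ) (forms : List (List R)) :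
    ∀ (q u : List ℕ), u.length = q.length → (∀ v ∈ u, v < V) →
      ((termWords V forms q).map fun e => if u = e.1 then e.2 else 0).sum =
        (List.zipWith (fun (ℓ : List R) (v : ℕ) => ℓ.getD v 0) (q.map fun j => forms.getD j []) u).prod := by
  -- the supports looked up through the map are the supports of the looked-up forms
  have hsup : ∀ j, ((forms.map (support V)).getD j []) = support V (forms.getD j []) :=
    fun j => getD_map_congr (support V) (support_nil V) forms j
  intro q
  induction q with
  | nil =>
    intro u hu _
    rw [List.length_nil, List.length_eq_zero_iff] at hu
    subst hu
    simp [termWords, prodWords]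
  | cons j q ih =>
    intro u hu hV
    match u, hu with
    | a :: u', hu =>
      have hu' : u'.length = q.length := by simpa using hu
      have hV' : ∀ v ∈ u', v < V := fun v hv => hV v (List.mem_cons_of_mem _ hv)
      have haV : a < V := hV a List.mem_cons_self
      -- unfold one step of the enumeration
      have step : ((termWords V forms (j :: q)).map fun e => if a :: u' = e.1 then e.2 else 0).sum =
          ((support V (forms.getD j [])).map fun v => if a = v then
            (forms.getD j []).getD a 0 *
              ((termWords V forms q).map fun e => if u' = e.1 then e.2 else 0).sum else 0).sum := by
        simp only [termWords, List.map_cons, prodWords]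
        simp only [hsup]
        rw [List.map_map, sum_map_flatMap]
        congr 1
        refine List.map_congr_left fun v _ => ?_
        rw [List.map_map]
        by_cases hav : a = v
        · subst hav
          rw [if_pos rfl, List.map_map, ← List.sum_map_mul_left]
          congr 1
          refine List.map_congr_left fun w _ => ?_
          simp only [Function.comp_apply, List.zipWith_cons_cons, List.prod_cons, List.cons.injEq,
            true_and]
          split_ifs with h
          · subst h; rfl
          · rw [mul_zero]
        · rw [if_neg hav]
          refine List.sum_eq_zero fun x hx => ?_
          rw [List.mem_map] at hx
          obtain ⟨w, _, rfl⟩ := hx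
          simp [hav]
      rw [step, sum_map_ite_eq_of_nodup a _ _ (nodup_support V _), ih u' hu' hV',
        List.map_cons, List.zipWith_cons_cons, List.prod_cons]
      split_ifs with ha
      · rfl
      · rw [(not_not.mp ((mem_support_iff V _ a haV).not.mp ha)), zero_mul]

omit [CommRing R] [DecidableEq R] in
/-- Words of a product enumeration have one letter per factor. [folklore] -/
private theorem length_of_mem_prodWords : ∀ (Ss : List (List ℕ)) (w : List ℕ), w ∈ prodWords Ss →
    w.length = Ss.length
  | [], w, h => by simp [prodWords] at h; simp [h]
  | S :: Ss, w, h => by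
    simp only [prodWords, List.mem_flatMap, List.mem_map] at h
    obtain ⟨v, -, w', hw', rfl⟩ := h
    simp [length_of_mem_prodWords Ss w' hw']

omit [CommRing R] [DecidableEq R] in
/-- Insertions lengthen by one. [folklore] -/
private theorem length_of_mem_insertions {α : Type*} (a : α) : ∀ (l : List α) (r : Bool × List α),
    r ∈ insertions a l → r.2.length = l.length + 1
  | [], r, h => by simp [insertions] at h; simp [h]
  | b :: l, r, h => by
    simp only [insertions, List.mem_cons, List.mem_map] at h
    rcases h with rfl | ⟨r', hr', rfl⟩
    · simp
    · simp [length_of_mem_insertions a l r' hr']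

omit [CommRing R] [DecidableEq R] in
/-- Signed permutations of a list have its length. [folklore] -/
private theorem length_of_mem_permsSign {α : Type*} : ∀ (l : List α) (q : Bool × List α),
    q ∈ permsSign l → q.2.length = l.length
  | [], q, h => by simp [permsSign] at h; simp [h]
  | a :: l, q, h => by
    simp only [permsSign, List.mem_flatMap, List.mem_map] at h
    obtain ⟨q', hq', r, hr, rfl⟩ := h
    simp [length_of_mem_insertions a q'.2 r hr, length_of_mem_permsSign l q' hq']

/-- Words of the symmetrised expansion have length `m`. [folklore] -/
private theorem length_of_mem_symList (P : Point R) (V m : ℕ) (e : List ℕ × R) (he : e ∈ symList P V m) :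
    e.1.length = m := by
  classical
  simp only [symList, List.mem_flatMap, List.mem_map] at he
  obtain ⟨t, -, q, hq, e', he', rfl⟩ := he
  simp only [termWords, List.mem_map] at he'
  obtain ⟨w, hw, rfl⟩ := he'
  rw [length_of_mem_prodWords _ _ hw, List.length_map, length_of_mem_permsSign _ _ hq,
    List.length_range]

omit [DecidableEq R] in
/-- The normal form of one term's contribution at a word: `∑_π ∏_p ℓ_{π p}[w_p]`. [folklore] -/
private theorem lperm_lookup_eq (forms : List (List R)) (m : ℕ) (hf : forms.length = m) (u : List ℕ)
    (hu : u.length = m) :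
    lperm (forms.map fun ℓ => u.map fun i => ℓ.getD i 0) =
      ∑ π : Equiv.Perm (Fin m), ∏ p : Fin m, (forms.getD (π p) []).getD (u.getD p 0) 0 := by
  rw [lperm_eq_permanent _ (by rw [List.length_map, hf]), Matrix.permanent]
  refine Finset.sum_congr rfl fun π _ => Finset.prod_congr rfl fun p _ => ?_
  rw [matOfRows, Matrix.of_apply]
  have h1 : (π p : ℕ) < forms.length := hf ▸ (π p).isLt
  have h2 : (p : ℕ) < u.length := hu ▸ p.isLt
  have e1 : (forms.map fun ℓ => u.map fun i => ℓ.getD i 0).getD (π p) [] =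
      u.map fun i => (forms[(π p : ℕ)]'h1).getD i 0 := by
    rw [List.getD_eq_getElem _ _ (by simpa using h1), List.getElem_map]
  have e2 : (u.map fun i => (forms[(π p : ℕ)]'h1).getD i 0).getD p 0 =
      (forms[(π p : ℕ)]'h1).getD (u[(p : ℕ)]'h2) 0 := by
    rw [List.getD_eq_getElem _ _ (by simpa using h2), List.getElem_map]
  rw [e1, e2, List.getD_eq_getElem _ _ h1, List.getD_eq_getElem _ _ h2]

omit [DecidableEq R] in
/-- The normal form of one arranged ordered product at a word. [folklore] -/
private theorem prod_zipWith_lookup_eq (forms : List (List R)) (m : ℕ) (π : Equiv.Perm (Fin m))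
    (u : List ℕ) (hu : u.length = m) :
    (List.zipWith (fun (ℓ : List R) (v : ℕ) => ℓ.getD v 0)
        ((List.ofFn fun r => ((π r : Fin m) : ℕ)).map fun j => forms.getD j []) u).prod =
      ∏ p : Fin m, (forms.getD (π p) []).getD (u.getD p 0) 0 := by
  have hu' : u = List.ofFn fun p : Fin m => u.getD p 0 := by
    subst hu
    conv_lhs => rw [← List.ofFn_getElem (xs := u)]
    exact List.ofFn_inj.mpr (funext fun p => (List.getD_eq_getElem _ _ p.isLt).symm)
  conv_lhs => rw [hu', List.map_ofFn, zipWith_ofFn, List.prod_ofFn]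
  rfl

/-- **The symmetrised expansion sums, at a word, to the symmetric-tensor entry** — column
expansion of the permanents `perm (ℓ_{t,s}[w_{s'}])_{s,s'}` making up `symEntry P w`. [folklore] -/
private theorem sum_symList (P : Point R) (V m : ℕ)
    (hP : ∀ t : Fin P.terms.length, (P.terms.get t).2.length = m)
    (u : List ℕ) (hu : u.length = m) (hV : ∀ v ∈ u, v < V) :
    ((symList P V m).map fun e => if u = e.1 then e.2 else 0).sum = symEntry P u := by
  unfold symList symEntry
  rw [sum_map_flatMap]
  congr 1
  refine List.map_congr_left fun t ht => ?_
  obtain ⟨ti, rfl⟩ := List.mem_iff_get.mp ht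
  rw [sum_map_flatMap]
  -- inner sums: pull out the coefficient, evaluate the ordered expansion at `u`
  have inner : ∀ q ∈ permsSign (List.range m),
      (((termWords V (P.terms.get ti).2 q.2).map fun e => (e.1, (P.terms.get ti).1 * e.2)).map
          fun e => if u = e.1 then e.2 else 0).sum =
        (P.terms.get ti).1 * (List.zipWith (fun (ℓ : List R) (v : ℕ) => ℓ.getD v 0)
          (q.2.map fun j => (P.terms.get ti).2.getD j []) u).prod := by
    intro q hq
    rw [← sum_termWords V _ q.2 u (by rw [hu, length_of_mem_permsSign _ _ hq, List.length_range]) hV,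
      List.map_map, ← List.sum_map_mul_left]
    congr 1
    refine List.map_congr_left fun e _ => ?_
    simp only [Function.comp_apply]
    split_ifs <;> simp
  rw [List.map_congr_left inner, List.sum_map_mul_left]
  congr 1
  rw [sum_permsSign_range m fun q => (List.zipWith (fun (ℓ : List R) (v : ℕ) => ℓ.getD v 0)
      (q.2.map fun j => (P.terms.get ti).2.getD j []) u).prod,
    lperm_lookup_eq _ m (hP ti) u hu]
  exact Finset.sum_congr rfl fun π _ => prod_zipWith_lookup_eq _ m π u hu

/-! ## §3 The sparse trie holds the symmetric-tensor entries -/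

/-- **`find w (sparseTrie P V m) = symEntry P w`** for every word `w` of length `m` with letters
`< V`, when every term of `P` has `m` forms: the sparse trie holds the polarised entries `q̂(α(w))` of the
evaluation formula of Dörfler–Ikenmeyer–Panova (there obtained by expanding the point's products of linear
forms). [cite: DorflerIkenmeyerPanova2020, §5] -/
theorem find_sparseTrie (P : Point R) (V m : ℕ)
    (hP : ∀ t : Fin P.terms.length, (P.terms.get t).2.length = m)
    (w : List ℕ) (hw : w.length = m) (hv : ∀ v ∈ w, v < V) :
    (sparseTrie P V m).find w = symEntry P w := by
  unfold sparseTrie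
  rw [PTrie.find_prune, PTrie.find_ofList _ m (length_of_mem_symList P V m) w hw,
    sum_symList P V m hP w hw hv]

/-! ## §4 Chunking the walk -/

omit [DecidableEq R] in
/-- **Chunking** of the label-major transfer-matrix evaluation (Dörfler–Ikenmeyer–Panova §5, label by
label): running the layers along `us ++ us'` is running them along `us`, then along `us'` from the layer
reached. Certificate modules that ship intermediate layers as literals check `layersA … usᵢ Lᵢ = Lᵢ₊₁`
chunk by chunk (one kernel evaluation each) and reassemble with this identity.
[cite: DorflerIkenmeyerPanova2020, §5] -/
theorem layersA_append (cols : List Column) (V : ℕ) (T : PTrie R) :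
    ∀ (us us' : List ℕ) (L : List (ℕ × List (List ℕ) × R)),
      layersA cols V T (us ++ us') L = layersA cols V T us' (layersA cols V T us L)
  | [], _, _ => rfl
  | u :: us, us', L => by
    rw [List.cons_append, layersA, layersA]
    exact layersA_append cols V T us us' _

/-! ## §5 The programme with the sparse trie computes `evalC` -/

/-- **The sparse-trie programme computes the specification** (with the trie's entries as entry
function). [folklore] -/
private theorem evalS_eq_specL (P : Point R) (N : Network) (hcs : N.columnStrict = true) :
    evalS P N = specL (fun w => (sparseTrie P N.varBound N.perLabel).find w)
      (List.range N.nlabels) N.cols := by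
  unfold evalS
  rw [List.range_eq_range', layerSum_layersA N.varBound _ N.cols (pairwise_of_columnStrict N hcs)
    N.nlabels 0 _ (fun e he => by simp [Network.initLayer] at he; subst he; simp)]
  simp [layerSpec, Network.initLayer, resid_zero]

/-- **The sparse-trie label-major programme computes the column-major evaluator** — the tableau
highest-weight-vector evaluation of Dörfler–Ikenmeyer–Panova §5 in its label-major transfer-matrix
organisation, run against the sparse entry trie: for a list point all of whose terms have `m` forms and a
column-strict network passing its structural check, `evalS P N = evalC P N`.
[cite: DorflerIkenmeyerPanova2020, §5] -/
theorem evalS_eq_evalC (P : Point R) (N : Network)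
    (hP : ∀ t : Fin P.terms.length, (P.terms.get t).2.length = N.perLabel)
    (hN : N.check = true) (hcs : N.columnStrict = true) : evalS P N = evalC P N := by
  obtain ⟨hlen, hlab, hcnt⟩ := Network.spec_of_check N hN
  have hV : 0 < N.varBound := Nat.succ_pos _
  let E := finEnum N.varBound hV
  rw [evalS_eq_specL P N hcs]
  refine specL_eq_evalC E P N hP hlen (fun c hc v hv => lt_varBound N c hc v hv) hlab hcnt hcs _
    fun w hw hv => ?_
  rw [← symEntry_eq_S E P hP w hw hv, find_sparseTrie P N.varBound N.perLabel hP w hw hv]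

end TableauEval

end Literature.Computability.AlgebraicComplexity
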